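import Mathlib
import Summits.Ventures.PercRepro2.Defs
import Summits.Ventures.PercRepro2.Independence
import Summits.Ventures.PercRepro2.Harris
import Summits.Ventures.PercRepro2.CoinDefs
import Summits.Ventures.PercRepro2.CoinArcsOff
import Summits.Ventures.PercRepro2.CoinInduced
import Summits.Ventures.PercRepro2.CoinVdBK
import Summits.Ventures.PercRepro2.CoinBHK
import Summits.Ventures.PercRepro2.CoinPendant
import Summits.Ventures.PercRepro2.CoinPendantDefs
import Summits.Ventures.PercRepro2.CoinTwoPendantDefs
import Summits.Ventures.PercRepro2.CoinTwoPendantMass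

/-!
# Row 2′DARC in FUNCTIONAL form: the gate functional for increasing cluster functionals (blind
cell PercRepro2, night-2 g3; proofs/NIGHT2-DARC.md §22.1 / §7 (DARC-fun))

`phiF p arcs s T F₁ F₂ 𝒟` is the cleared centred functional `P(R_T)²·Φ(𝒟)` of `CoinDefs.phiC`
with the point markers replaced by `X = F₁(S⁺)`, `Y = F₂(S⁺)` (`S⁺ = clusterC arcs ω s`), and
`DARCF` the row for the gate event.  The two directed-BHK inputs on any `SameEnds` system follow
from `bhkC`: the conditional covariance (`covF_nonneg`, `X = Y = U`) and the shift
`E[F; R_{U′}]·P(R_U) ≤ E[F; R_U]·P(R_{U′})` for `U ⊆ U′` (`shiftF`, `F₂ = 1`); `massE_le_prob_of_le_one`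
bounds the masses of a `[0, 1]`-valued functional.
-/

namespace Summit.Ventures.PercRepro2.Coin

section Defs

open Classical

variable {V : Type*} {E : Type*} [Fintype E] [DecidableEq E] {R : Type*} [CommRing R]

/-- The cleared centred gate functional for cluster functionals `F₁, F₂` (cf. `phiC`). -/
noncomputable def phiF (p : E → R) (arcs : E → Finset (V × V)) (s : V) (T : Finset V)
    (F₁ F₂ : Set V → R) (D : Set (Config E)) : R :=
  let X := fun ω => F₁ (clusterC arcs ω s)
  let Y := fun ω => F₂ (clusterC arcs ω s)
  let RT := avoidEvent arcs s T
  prob p RT ^ 2 * massE p (fun ω => X ω * Y ω) D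
    - prob p RT * massE p X RT * massE p Y D
    - prob p RT * massE p Y RT * massE p X D
    + massE p X RT * massE p Y RT * prob p D

/-- **Row 2′DARC, functional form**: `Φ(s ↛ T in D + (u → w)) ≥ 0` for the cluster functionals
`F₁, F₂`. -/
def DARCF [LinearOrder R] (p : E → R) (arcs : E → Finset (V × V)) (s : V) (T : Finset V)
    (F₁ F₂ : Set V → R) (u w : V) : Prop :=
  0 ≤ phiF p arcs s T F₁ F₂ (gateEvent arcs s T u w)

end Defs

section Inputs

open Classical

variable {V : Type*} {E : Type*} [Fintype V] [DecidableEq V] [Fintype E] [DecidableEq E]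
  {R : Type*} [CommRing R] [LinearOrder R] [IsStrictOrderedRing R]

omit [Fintype V] [DecidableEq V] in
/-- A `[0, 1]`-valued observable has mass at most the probability of the event. -/
lemma massE_le_prob_of_le_one (p : E → R) (hp : IsProbVec p) {f : Config E → R}
    (hf1 : ∀ ω, f ω ≤ 1) (D : Set (Config E)) :
    massE p f D ≤ prob p D := by
  rw [prob_eq_massE_one]
  unfold massE expect
  refine Finset.sum_le_sum fun ω _ => mul_le_mul_of_nonneg_left ?_ (weight_nonneg hp ω)
  by_cases hD : ω ∈ D
  · rw [Set.indicator_of_mem hD, Set.indicator_of_mem hD]; exact hf1 ω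
  · rw [Set.indicator_of_notMem hD, Set.indicator_of_notMem hD]

omit [Fintype V] [DecidableEq V] in
/-- A nonnegative observable has nonnegative mass. -/
lemma massE_nonneg_of_nonneg (p : E → R) (hp : IsProbVec p) {f : Config E → R}
    (hf0 : ∀ ω, 0 ≤ f ω) (D : Set (Config E)) : 0 ≤ massE p f D := by
  unfold massE expect
  refine Finset.sum_nonneg fun ω _ => mul_nonneg (weight_nonneg hp ω) ?_
  by_cases hD : ω ∈ D
  · rw [Set.indicator_of_mem hD]; exact hf0 ω
  · rw [Set.indicator_of_notMem hD]

/-- **The conditional covariance of two increasing cluster functionals on an avoidance event is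
nonnegative** (directed BHK, `bhkC` with `X = Y`), cleared form. -/
theorem covF_nonneg (p : E → R) (hp : IsProbVec p) {arcs : E → Finset (V × V)}
    (hS : SameEnds arcs) (s : V) {F₁ F₂ : Set V → R} (hF₁ : Monotone F₁) (hF₂ : Monotone F₂)
    (hF₁0 : ∀ S, 0 ≤ F₁ S) (hF₂0 : ∀ S, 0 ≤ F₂ S) (U : Finset V) :
    massE p (fun ω => F₁ (clusterC arcs ω s)) (avoidEvent arcs s U) *
        massE p (fun ω => F₂ (clusterC arcs ω s)) (avoidEvent arcs s U) ≤
      massE p (fun ω => F₁ (clusterC arcs ω s) * F₂ (clusterC arcs ω s)) (avoidEvent arcs s U) *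
        prob p (avoidEvent arcs s U) := by
  have h := bhkC p hp hS s hF₁ hF₂ hF₁0 hF₂0 U U
  rw [expect_mul_indicator_one, expect_mul_indicator_one, expect_mul_indicator_one,
    Finset.inter_self, Finset.union_self] at h
  exact h

/-- **The shift of an increasing cluster functional along an inclusion of avoided sets**
(`bhkC` with `F₂ = 1`): `E[F; R_{U′}]·P(R_U) ≤ E[F; R_U]·P(R_{U′})` for `U ⊆ U′`. -/
theorem shiftF (p : E → R) (hp : IsProbVec p) {arcs : E → Finset (V × V)} (hS : SameEnds arcs)
    (s : V) {F : Set V → R} (hF : Monotone F) (hF0 : ∀ S, 0 ≤ F S) {U U' : Finset V}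
    (hUU' : U ⊆ U') :
    massE p (fun ω => F (clusterC arcs ω s)) (avoidEvent arcs s U') * prob p (avoidEvent arcs s U) ≤
      massE p (fun ω => F (clusterC arcs ω s)) (avoidEvent arcs s U) *
        prob p (avoidEvent arcs s U') := by
  have h := bhkC p hp hS s hF (fun _ _ _ => le_rfl : Monotone (fun _ : Set V => (1 : R))) hF0
    (fun _ => zero_le_one) U' U
  rw [expect_mul_indicator_one, expect_mul_indicator_one, expect_mul_indicator_one,
    Finset.inter_eq_right.mpr hUU', Finset.union_eq_left.mpr hUU'] at h
  simp only [Pi.mul_apply, mul_one] at h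
  rw [← prob_eq_massE_one] at h
  exact h

end Inputs

end Summit.Ventures.PercRepro2.Coin
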